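import Summits.Ventures.HodgeRepro.Tier4.Line1.KernelUnfold

/-!
# Tier4/Line1/KernelSpectral — LINE L1, lemma L1.2a `kernel_spectral` (t4-L1-p3)

Blind re-derivation cell `pub-hodge-repro`, Tier 4 (README §9–§10), seat t4-L1-p3.  The lemma L1.2a of the line's
skeleton (proofs/t4-plan-1/Tier4/Line1/Skeleton.lean v0.8, L426–L430) restated BYTE-IDENTICALLY and PROVED over every
`RTF.Setting G`: the automorphic kernel of the convolution `f₁ ⋆ f₂` expands along an adapted orthonormal family,
`K_{f₁⋆f₂}(x, y) = ∑_j (R(f₂ˇ)φ_j)(y) · conj((R(f̄₁)φ_j)(x))` as a `HasSum`.  Mathlib only, no printed input.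

* (T3c) `kernel_conv_eq`: `K_{f₁⋆f₂}(x, y) = ∫_{DG} K_{f₁}(x, w) K_{f₂}(w, y) dw` — the substitution `h = x⁻¹w` inside
  the convolution, only finitely many rational `γ` meet `x · supp f₁ · supp f₂ · y⁻¹` (T1 of `KernelUnfold`), so the
  sum over `G(k)` passes inside the integral, then the unfolding (T2) and `kernel_mul_left`.
* (T4) PARSEVAL: the family `φ_j` is orthonormal in `L²(DG, μ)` (`orth` at `j = j'` forces `φ_j ∈ L²`) and complete
  (`complete`), hence a `HilbertBasis` of `L²(DG, μ)` (`HilbertBasis.mkOfOrthogonalEqBot`);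
  `HilbertBasis.hasSum_inner_mul_inner` applied to `A = K_{f₁}(x, ·)|_{DG}` and `B = conj K_{f₂}(·, y)|_{DG}` is the
  statement once `R_refl_eq`, `R_cj_eq` and `kernel_conv_eq` identify the three inner products.
The fields `irred` and `rightInv` of the setting are not used; no Fubini / product measurability is needed (every
integral is a single integral over `G`).

Nothing here says anything about the status of the Hodge conjecture for CM abelian varieties, which is NOT proved
(HC_CM is NOT proved by anyone in this repository).
-/

set_option autoImplicit false

noncomputable section

namespace Summit.Ventures.HodgeRepro.Tier4.Line1.RTF.Setting

open MeasureTheory Topology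
open scoped InnerProductSpace Pointwise

variable {G : Type} [Group G] [TopologicalSpace G] [IsTopologicalGroup G] [MeasurableSpace G]
  [BorelSpace G]

variable (S : Setting G)

/-- (T3c) the kernel of a convolution is the composition of the kernels over `DG`:
`K_{f₁⋆f₂}(x, y) = ∫_{DG} K_{f₁}(x, w) K_{f₂}(w, y) dw`. -/
theorem kernel_conv_eq {f₁ f₂ : G → ℂ} (h₁ : IsTest f₁) (h₂ : IsTest f₂) (x y : G) :
    S.kernel (S.conv f₁ f₂) x y = ∫ w in S.DG, S.kernel f₁ x w * S.kernel f₂ w y ∂S.μ := by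
  haveI := S.haar
  -- finitely many rational `γ` meet `x · supp f₁ · supp f₂ · y⁻¹`
  have hM : IsCompact ((fun p : G × G => x * p.1 * p.2 * y⁻¹) '' (tsupport f₁ ×ˢ tsupport f₂)) :=
    (h₁.compact.prod h₂.compact).image (by fun_prop)
  obtain hfin := S.finite_rational_of_isCompact hM
  set Γ := hfin.toFinset with hΓdef
  have hΓ : ∀ γ : S.Gk, ∀ w : G, f₁ (x⁻¹ * w) ≠ 0 → f₂ (w⁻¹ * γ * y) ≠ 0 → γ ∈ Γ := by
    intro γ w hw hne
    rw [hΓdef, Set.Finite.mem_toFinset]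
    refine ⟨(x⁻¹ * w, w⁻¹ * γ * y), ⟨subset_tsupport _ hw, subset_tsupport _ hne⟩, ?_⟩
    simp only
    group
  -- the substitution `h = x⁻¹ w` inside the convolution
  have h1 : ∀ γ : S.Gk, S.conv f₁ f₂ (x⁻¹ * γ * y) = ∫ w, f₁ (x⁻¹ * w) * f₂ (w⁻¹ * γ * y) ∂S.μ := by
    intro γ
    unfold conv
    have := integral_mul_left_eq_self (μ := S.μ) (fun h => f₁ h * f₂ (h⁻¹ * (x⁻¹ * γ * y))) x⁻¹
    rw [← this]
    congr 1
    funext w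
    congr 2
    group
  -- only the finitely many `γ ∈ Γ` contribute, and the sum passes inside the integral
  have h2 : S.kernel (S.conv f₁ f₂) x y = ∫ w, ∑ γ ∈ Γ, f₁ (x⁻¹ * w) * f₂ (w⁻¹ * γ * y) ∂S.μ := by
    unfold kernel
    simp_rw [h1]
    have hint : ∀ γ ∈ Γ, Integrable (fun w => f₁ (x⁻¹ * w) * f₂ (w⁻¹ * γ * y)) S.μ := by
      intro γ _
      refine ((h₁.cont.comp (continuous_const.mul continuous_id)).mul
        (h₂.cont.comp (by fun_prop))).integrable_of_hasCompactSupport ?_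
      exact (h₁.compact.comp_homeomorph (Homeomorph.mulLeft x⁻¹)).mul_right
    rw [tsum_eq_sum (s := Γ), integral_finsetSum Γ hint]
    intro γ hγ
    have h0 : ∀ w, f₁ (x⁻¹ * w) * f₂ (w⁻¹ * γ * y) = 0 := by
      intro w
      by_contra hne
      rcases mul_ne_zero_iff.mp hne with ⟨ha, hb⟩
      exact hγ (hΓ γ w ha hb)
    simp only [h0, integral_zero]
  -- pointwise, the finite sum is `f₁(x⁻¹ w) K_{f₂}(w, y)`
  have h3 : ∀ w, ∑ γ ∈ Γ, f₁ (x⁻¹ * w) * f₂ (w⁻¹ * γ * y) = f₁ (x⁻¹ * w) * S.kernel f₂ w y := by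
    intro w
    rw [← Finset.mul_sum]
    by_cases hw : f₁ (x⁻¹ * w) = 0
    · simp [hw]
    · congr 1
      unfold kernel
      symm
      apply tsum_eq_sum
      intro γ hγ
      by_contra hne
      exact hγ (hΓ γ w hw hne)
  have hHeq : (fun w => f₁ (x⁻¹ * w) * S.kernel f₂ w y) =
      fun w => ∑ γ ∈ Γ, f₁ (x⁻¹ * w) * f₂ (w⁻¹ * γ * y) := by
    funext w
    exact (h3 w).symm
  have hc : Continuous (fun w => f₁ (x⁻¹ * w) * S.kernel f₂ w y) := by
    rw [hHeq]
    exact continuous_finsetSum _ (fun γ _ => (h₁.cont.comp (continuous_const.mul continuous_id)).mul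
      (h₂.cont.comp (by fun_prop)))
  have hs : HasCompactSupport (fun w => f₁ (x⁻¹ * w) * S.kernel f₂ w y) :=
    (h₁.compact.comp_homeomorph (Homeomorph.mulLeft x⁻¹)).mul_right
  rw [h2]
  simp only [h3]
  rw [S.integral_eq_setIntegral_tsum hc hs]
  apply setIntegral_congr_fun₀ S.fdG.nullMeasurableSet
  intro w _
  simp only [S.kernel_mul_left f₂]
  rw [tsum_mul_right]
  congr 1
  unfold kernel
  apply tsum_congr
  intro δ
  rw [mul_assoc]

/-- L1.2a (L): the kernel of the convolution `f₁ ⋆ f₂` expands along an adapted orthonormal family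
(the kernel of a product is the composition of the kernels; Parseval on `L²(G(k)\G)`; the two
factors are `R(f̄₁) φ_j` and `R(f₂ˇ) φ_j`). -/
theorem kernel_spectral {τ : ℕ → Set (G → ℂ)} {φ : ℕ → G → ℂ} {n : ℕ → ℕ}
    (hB : S.IsAdaptedONB τ φ n) {f₁ f₂ : G → ℂ} (h₁ : IsTest f₁) (h₂ : IsTest f₂) (x y : G) :
    HasSum (fun j => S.R (refl f₂) (φ j) y * starRingEnd ℂ (S.R (cj f₁) (φ j) x))
      (S.kernel (S.conv f₁ f₂) x y) := by
  haveI := S.haar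
  haveI := S.isFiniteMeasure_restrict_DG
  -- the family: continuous, invariant, in `L²(DG)`
  have hφc : ∀ j, Continuous (φ j) := fun j => (hB.inv (n j)).cont _ (hB.mem j)
  have hφi : ∀ j, S.Invariant (φ j) := fun j => (hB.inv (n j)).inv _ (hB.mem j)
  have hφL : ∀ j, MemLp (φ j) 2 (S.μ.restrict S.DG) := fun j =>
    S.memLp_of_inner_self_eq_one (hφc j) (by simpa using hB.orth j j)
  let v : ℕ → Lp ℂ 2 (S.μ.restrict S.DG) := fun j => (hφL j).toLp (φ j)
  -- the inner product of two `toLp`'s is the `L²(DG)` integral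
  have hinner : ∀ (a b : G → ℂ) (ha : MemLp a 2 (S.μ.restrict S.DG))
      (hb : MemLp b 2 (S.μ.restrict S.DG)),
      ⟪ha.toLp a, hb.toLp b⟫_ℂ = ∫ w in S.DG, b w * starRingEnd ℂ (a w) ∂S.μ := by
    intro a b ha hb
    rw [L2.inner_def]
    apply integral_congr_ae
    filter_upwards [ha.coeFn_toLp, hb.coeFn_toLp] with w hwa hwb
    rw [hwa, hwb, RCLike.inner_apply]
  -- orthonormal
  have hv : Orthonormal ℂ v := by
    rw [orthonormal_iff_ite]
    intro i j
    have h := hB.orth j i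
    unfold Setting.inner at h
    show ⟪(hφL i).toLp (φ i), (hφL j).toLp (φ j)⟫_ℂ = _
    rw [hinner, h]
    by_cases hij : i = j
    · simp [hij]
    · simp [hij, Ne.symm hij]
  -- complete
  have hsp : (Submodule.span ℂ (Set.range v))ᗮ = ⊥ := by
    rw [Submodule.eq_bot_iff]
    intro ψ hψ
    rw [Submodule.mem_orthogonal] at hψ
    have hz : ∀ j, S.inner (ψ : G → ℂ) (φ j) = 0 := by
      intro j
      have h := hψ (v j) (Submodule.subset_span ⟨j, rfl⟩)
      rw [L2.inner_def] at h
      unfold Setting.inner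
      rw [← h]
      apply integral_congr_ae
      filter_upwards [(hφL j).coeFn_toLp] with w hw
      show _ = ⟪(v j) w, ψ w⟫_ℂ
      rw [hw, RCLike.inner_apply]
    exact Lp.eq_zero_iff_ae_eq_zero.mpr (hB.complete ψ (Lp.memLp ψ) hz)
  let b : HilbertBasis ℕ ℂ (Lp ℂ 2 (S.μ.restrict S.DG)) := HilbertBasis.mkOfOrthogonalEqBot hv hsp
  have hb : ∀ j, b j = v j := fun j => by
    simp only [b, HilbertBasis.coe_mkOfOrthogonalEqBot]
  -- the two kernel vectors
  have hA : MemLp (fun w => S.kernel f₁ x w) 2 (S.μ.restrict S.DG) := S.kernel_left_memLp h₁ x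
  have hBm : MemLp (fun w => starRingEnd ℂ (S.kernel f₂ w y)) 2 (S.μ.restrict S.DG) :=
    (S.kernel_right_memLp h₂ y).star
  have key := b.hasSum_inner_mul_inner (hBm.toLp _) (hA.toLp _)
  -- identify the three inner products
  have e1 : ∀ j, ⟪hBm.toLp _, b j⟫_ℂ = S.R (refl f₂) (φ j) y := by
    intro j
    rw [hb, hinner, S.R_refl_eq h₂ (hφc j) (hφi j) y]
    apply setIntegral_congr_fun₀ S.fdG.nullMeasurableSet
    intro w _
    simp only [RCLike.conj_conj, mul_comm]
  have e2 : ∀ j, ⟪b j, hA.toLp _⟫_ℂ = starRingEnd ℂ (S.R (cj f₁) (φ j) x) := by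
    intro j
    rw [hb, hinner, S.R_cj_eq h₁ (hφc j) (hφi j) x, ← integral_conj]
    apply setIntegral_congr_fun₀ S.fdG.nullMeasurableSet
    intro w _
    simp only [map_mul, RCLike.conj_conj]
  have e3 : ⟪hBm.toLp _, hA.toLp _⟫_ℂ = S.kernel (S.conv f₁ f₂) x y := by
    rw [hinner, S.kernel_conv_eq h₁ h₂ x y]
    apply setIntegral_congr_fun₀ S.fdG.nullMeasurableSet
    intro w _
    simp only [RCLike.conj_conj]
  simp only [e1, e2, e3] at key
  exact key

end Summit.Ventures.HodgeRepro.Tier4.Line1.RTF.Setting
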